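import Summits.QuantumFields.GaugeBoot.PeriodicWordSymmetry
import Summits.QuantumFields.GaugeBoot.TiltedLatticeAxisSwap
import Summits.QuantumFields.GaugeBoot.TiltedLatticeAxisFlip
import Summits.QuantumFields.GaugeBoot.WordSymmetry
import HarnessLib

/-!
# Word holonomies under axis swaps and axis flips of a periodic lattice: symmetry identifications of loop variables (gauge-boot, periodic loop equations, supplement)

HONEST FRAMING (cell `pub-gaugeboot`, page 1 of every file): the venture produces certified bounds
on lattice expectations at stated coupling, gauge group, dimension and torus size; NOT a mass gap,
NOT a continuum limit, NOT a string tension; NOT Yang–Mills-summit-bearing (barriers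
`FixedCouplingUltralocality`, `PerturbativeInvisibility`).

Companion of `PeriodicWordSymmetry.lean` (translations). The remaining symmetries of a periodic
lattice `(A, e)` that the tree proves for the Wilson measure `μ_β = gibbs ρ e β` act on WORDS:

* an **axis swap** `θ` (`IsAxisSwap e k l θ`, `TiltedLatticeAxisSwap.lean`; every tilted diagonal
  frame is one, `IsTiltedFrame.isAxisSwap`, so this covers the diagonal mirror `x_i ↔ x_j` of the
  45°-tilted box as well as the swaps of two axes `∉ {i, j}`): the configuration `configSwap k l θ U`
  reads the word `w` from `x` as `U` reads the RELABELLED word `w.map (Step.permute (swap k l))` from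
  `θ x` (`IsAxisSwap.wordHolonomy_configSwap`);
* an **axis flip** `σ` (`IsAxisFlip e k σ`, `TiltedLatticeAxisFlip.lean`; on the tilted box: every axis
  `∉ {i, j}`, and `i`, `j` themselves on the square box): the Osterwalder–Seiler reflected configuration
  `configReflect e k σ U` (`k`-links reversed and inverted) reads `w` from `x` as `U` reads the word with
  its `k`-steps REVERSED, `w.map (Step.flipAt k)`, from `σ x` (`IsAxisFlip.wordHolonomy_configReflect`).

Since `μ_β` is invariant under both (every real `β`), the loop and pair expectations of a word equal
those of its relabelled / flipped image (`IsAxisSwap.integral_trace_wordHolonomy_permute`,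
`IsAxisFlip.integral_trace_wordHolonomy_flipAt`, and the pair versions) — the identifications that
quotient the variable set of a tilted-box certificate by the box's symmetry group (smaller than the
hypercubic group: tribunal t1 v2.3 A14). A flip enters ONLY as such an identification, never as a PSD
block (`TiltedBoxAxisRPNegative.lean`). Everything is `[folklore]`.

References: V. Kazakov, Z. Zheng, arXiv:2203.11360 §3.3 "Reduction by Symmetry Group" (symmetry
reduction of the loop variables; locator per tribunal t2 add5 F-R18).
-/

noncomputable section

open MeasureTheory

namespace Summit.QuantumFields.GaugeBoot

namespace Step

variable {d : ℕ}

/-- Reversal of the steps along ONE axis `k`: `±e_k ↦ ∓e_k`, other steps unchanged (the action of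
the flip `x_k ↦ -x_k` on words; `reflect0` of `WordSymmetry.lean` is the case `k = 0`). [folklore] -/
def flipAt (k : Fin d) : Step d → Step d
  | fwd μ => if μ = k then bwd μ else fwd μ
  | bwd μ => if μ = k then fwd μ else bwd μ

/-- `flipAt` on the forward step along the flipped axis. [folklore] -/
@[simp] theorem flipAt_fwd_self (k : Fin d) : (fwd k : Step d).flipAt k = bwd k := by simp [flipAt]

/-- `flipAt` on the backward step along the flipped axis. [folklore] -/
@[simp] theorem flipAt_bwd_self (k : Fin d) : (bwd k : Step d).flipAt k = fwd k := by simp [flipAt]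

/-- `flipAt` on a forward step along another axis. [folklore] -/
theorem flipAt_fwd_of_ne {k μ : Fin d} (h : μ ≠ k) : (fwd μ : Step d).flipAt k = fwd μ := by
  simp [flipAt, h]

/-- `flipAt` on a backward step along another axis. [folklore] -/
theorem flipAt_bwd_of_ne {k μ : Fin d} (h : μ ≠ k) : (bwd μ : Step d).flipAt k = bwd μ := by
  simp [flipAt, h]

end Step

namespace TiltedRP

variable {A : Type*} [AddCommGroup A] {d N : ℕ} {G : Type*} [Group G]

/-! ### Axis swaps -/

namespace IsAxisSwap

variable {e : Fin d → A} {k l : Fin d} {θ : A →+ A} (hF : IsAxisSwap e k l θ)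
include hF

/-- The swap carries the endpoint of a step to the endpoint of the relabelled step. [folklore] -/
theorem map_move (x : A) (s : Step d) :
    θ (s.move e x) = (s.permute (Equiv.swap k l)).move e (θ x) := by
  cases s with
  | fwd μ => rw [Step.move_fwd, Step.permute_fwd, Step.move_fwd, hF.map_add_e]
  | bwd μ => rw [Step.move_bwd, Step.permute_bwd, Step.move_bwd, map_sub, hF.map_e]

/-- A step holonomy of the swapped configuration is the relabelled step read from `θ x`. [folklore] -/
theorem stepHolonomy_configSwap (U : Config A d G) (x : A) (s : Step d) :
    stepHolonomy e (configSwap k l θ U) x s = stepHolonomy e U (θ x) (s.permute (Equiv.swap k l)) := by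
  cases s with
  | fwd μ => rfl
  | bwd μ =>
    rw [Step.permute_bwd, stepHolonomy_bwd, stepHolonomy_bwd, configSwap_apply, linkSwap_mk, map_sub,
      hF.map_e]

/-- **Word holonomies under an axis swap**: `hol_x(w)(Θ U) = hol_{θx}(w^π)(U)`, `π = (k l)` acting
letterwise. [folklore] -/
theorem wordHolonomy_configSwap (U : Config A d G) : ∀ (x : A) (w : Word d),
    wordHolonomy e (configSwap k l θ U) x w =
      wordHolonomy e U (θ x) (w.map (Step.permute (Equiv.swap k l)))
  | x, [] => rfl
  | x, s :: w => by
    rw [List.map_cons, wordHolonomy_cons, wordHolonomy_cons, hF.stepHolonomy_configSwap,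
      wordHolonomy_configSwap U, hF.map_move]

variable [Fintype A] [TopologicalSpace G] [IsTopologicalGroup G] [CompactSpace G] [MeasurableSpace G]
  [BorelSpace G] [SecondCountableTopology G] (ρ : G →* Matrix (Fin N) (Fin N) ℂ)

/-- **Loop expectations are invariant under an axis swap**:
`E[tr ρ(hol_{θx}(w^π))] = E[tr ρ(hol_x(w))]` (every real `β`). [folklore] -/
theorem integral_trace_wordHolonomy_permute (hρ : Continuous ρ) (β : ℝ) (x : A) (w : Word d) :
    ∫ U, (ρ (wordHolonomy e U (θ x) (w.map (Step.permute (Equiv.swap k l))))).trace ∂(gibbs ρ e β) =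
      ∫ U, (ρ (wordHolonomy e U x w)).trace ∂(gibbs ρ e β) := by
  have h := hF.integral_comp_configSwap_gibbs_complex ρ hρ β
    (F := fun U => (ρ (wordHolonomy e U x w)).trace) (measurable_trace_wordHolonomy ρ hρ e x w)
  simp only [hF.wordHolonomy_configSwap] at h
  exact h

/-- **Pair expectations are invariant under an axis swap.** [folklore] -/
theorem integral_trace_mul_trace_wordHolonomy_permute (hρ : Continuous ρ) (β : ℝ) (x : A) (u v : Word d) :
    ∫ U, (ρ (wordHolonomy e U (θ x) (u.map (Step.permute (Equiv.swap k l))))).trace *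
        (ρ (wordHolonomy e U (θ x) (v.map (Step.permute (Equiv.swap k l))))).trace ∂(gibbs ρ e β) =
      ∫ U, (ρ (wordHolonomy e U x u)).trace * (ρ (wordHolonomy e U x v)).trace ∂(gibbs ρ e β) := by
  have h := hF.integral_comp_configSwap_gibbs_complex ρ hρ β
    (F := fun U => (ρ (wordHolonomy e U x u)).trace * (ρ (wordHolonomy e U x v)).trace)
    ((measurable_trace_wordHolonomy ρ hρ e x u).mul (measurable_trace_wordHolonomy ρ hρ e x v))
  simp only [hF.wordHolonomy_configSwap] at h
  exact h

end IsAxisSwap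

/-! ### Axis flips -/

namespace IsAxisFlip

variable {e : Fin d → A} {k : Fin d} {σ : A →+ A} (hF : IsAxisFlip e k σ)
include hF

/-- The flip carries the endpoint of a step to the endpoint of the flipped step. [folklore] -/
theorem map_move (x : A) (s : Step d) : σ (s.move e x) = (s.flipAt k).move e (σ x) := by
  cases s with
  | fwd μ =>
    by_cases h : μ = k
    · subst h; rw [Step.move_fwd, Step.flipAt_fwd_self, Step.move_bwd, hF.map_add_self]
    · rw [Step.move_fwd, Step.flipAt_fwd_of_ne h, Step.move_fwd, hF.map_add_other x h]
  | bwd μ =>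
    by_cases h : μ = k
    · subst h; rw [Step.move_bwd, Step.flipAt_bwd_self, Step.move_fwd, hF.map_sub_self]
    · rw [Step.move_bwd, Step.flipAt_bwd_of_ne h, Step.move_bwd, map_sub, hF.map_e_other μ h]

/-- A step holonomy of the reflected configuration is the flipped step read from `σ x` (the reversed
and inverted `k`-links become the reversed `k`-steps). [folklore] -/
theorem stepHolonomy_configReflect (U : Config A d G) (x : A) (s : Step d) :
    stepHolonomy e (configReflect e k σ U) x s = stepHolonomy e U (σ x) (s.flipAt k) := by
  cases s with
  | fwd μ =>
    by_cases h : μ = k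
    · subst h; rw [Step.flipAt_fwd_self, stepHolonomy_fwd, stepHolonomy_bwd, configReflect_self]
    · rw [Step.flipAt_fwd_of_ne h, stepHolonomy_fwd, stepHolonomy_fwd, configReflect_other e k σ U x h]
  | bwd μ =>
    by_cases h : μ = k
    · subst h
      rw [Step.flipAt_bwd_self, stepHolonomy_bwd, stepHolonomy_fwd, configReflect_self, inv_inv,
        hF.map_sub_self, add_sub_cancel_right]
    · rw [Step.flipAt_bwd_of_ne h, stepHolonomy_bwd, stepHolonomy_bwd, configReflect_other e k σ U _ h,
        map_sub, hF.map_e_other μ h]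

/-- **Word holonomies under an axis flip**: `hol_x(w)(Θ U) = hol_{σx}(w^♭)(U)`, `♭` reversing the
`k`-steps letterwise. [folklore] -/
theorem wordHolonomy_configReflect (U : Config A d G) : ∀ (x : A) (w : Word d),
    wordHolonomy e (configReflect e k σ U) x w = wordHolonomy e U (σ x) (w.map (Step.flipAt k))
  | x, [] => rfl
  | x, s :: w => by
    rw [List.map_cons, wordHolonomy_cons, wordHolonomy_cons, hF.stepHolonomy_configReflect,
      wordHolonomy_configReflect U, hF.map_move]

variable [Fintype A] [TopologicalSpace G] [IsTopologicalGroup G] [CompactSpace G] [MeasurableSpace G]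
  [BorelSpace G] [SecondCountableTopology G] (ρ : G →* Matrix (Fin N) (Fin N) ℂ)

/-- **Loop expectations are invariant under an axis flip**:
`E[tr ρ(hol_{σx}(w^♭))] = E[tr ρ(hol_x(w))]` (every real `β`). [folklore] -/
theorem integral_trace_wordHolonomy_flipAt (hρ : Continuous ρ) (β : ℝ) (x : A) (w : Word d) :
    ∫ U, (ρ (wordHolonomy e U (σ x) (w.map (Step.flipAt k)))).trace ∂(gibbs ρ e β) =
      ∫ U, (ρ (wordHolonomy e U x w)).trace ∂(gibbs ρ e β) := by
  have h := hF.integral_comp_configReflect_gibbs_complex ρ hρ β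
    (F := fun U => (ρ (wordHolonomy e U x w)).trace) (measurable_trace_wordHolonomy ρ hρ e x w)
  simp only [hF.wordHolonomy_configReflect] at h
  exact h

/-- **Pair expectations are invariant under an axis flip.** [folklore] -/
theorem integral_trace_mul_trace_wordHolonomy_flipAt (hρ : Continuous ρ) (β : ℝ) (x : A) (u v : Word d) :
    ∫ U, (ρ (wordHolonomy e U (σ x) (u.map (Step.flipAt k)))).trace *
        (ρ (wordHolonomy e U (σ x) (v.map (Step.flipAt k)))).trace ∂(gibbs ρ e β) =
      ∫ U, (ρ (wordHolonomy e U x u)).trace * (ρ (wordHolonomy e U x v)).trace ∂(gibbs ρ e β) := by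
  have h := hF.integral_comp_configReflect_gibbs_complex ρ hρ β
    (F := fun U => (ρ (wordHolonomy e U x u)).trace * (ρ (wordHolonomy e U x v)).trace)
    ((measurable_trace_wordHolonomy ρ hρ e x u).mul (measurable_trace_wordHolonomy ρ hρ e x v))
  simp only [hF.wordHolonomy_configReflect] at h
  exact h

end IsAxisFlip

end TiltedRP

end Summit.QuantumFields.GaugeBoot

end
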